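import Summits.CriticalPhenomena.PercolationContinuityZ3.Theorems.PercPorousCriticalFiniteClusterVolumeTailSummitEquiv
import Literature.Probability.Percolation.DiscontinuityGammaTwo
import Literature.Probability.Percolation.SusceptibilityGammaOne
import HarnessLib

/-!
# Crux `FiniteClusterVolumeTail` (K, stmt-CriticalPhenomena-0943) — EXEMPT-46 decomposition re-exam, typed companion

Strategist workfile (planner-cstrat-stmt-CriticalPhenomena-0943-r1-0, 2026-08-17), companion of
`Cruxes/FiniteClusterVolumeTail/STRATEGY-CENSUS.md` §R (the r1 re-exam under the BC2-REDIRECT letters (a)–(d)).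
NOT a line: no stubs, no `sorry`. It types the pieces of the candidate decompositions of K that live on the
two axes of the four K-routes (the γ-axis of PercDebrisSweep and the volume-tail-exponent axis shared by all four)
and proves what is cheap about them:

* `K_iff_S`, `K_debrisSweep_iff_S` — the driving fact, by name: K ↔ PercolationContinuityZ3 (p158843, unconditional).
* `KEta η` — the same-density finite-cluster tail with stretched exponent `η` ("K-ladder"); `kEta_twoThirds_iff_K`
  (`KEta (2/3)` IS K, `Iff.rfl`), `kEta_anti` (the ladder is monotone), `kEta_of_S` (every rung `η ≤ 2/3` is a
  CONSEQUENCE of the conjunct) — so a rung is admissible as a piece only if it is also USED toward S, and its (d)-plan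
  is the whole question (census §R3).
* `ChiBelow g` — subcritical susceptibility exponent `< g` (`ChiBelow 3` IS `PercDebrisSweep.SubcritChiBelowCube`,
  `Iff.rfl`); `chiBelow_mono`.
* `summit_of_chiBelow_of_kEta` — **the debris-sweep trade-off line, PROVED**: for `0 < η` and `1 - 1/max g 1 ≤ η`,
  `ChiBelow g → KEta η → DebrisFromChi → PercolationContinuityZ3` (the route's `closes` with `(3, 2/3)` replaced by
  `(g, η)`; real analysis only). This is letter (b) for decomposition D8 of the census.
* `summit_of_chiBelow_two` — **at `g = 2` the γ-piece gives the conjunct ON ITS OWN** (Newman 1986 via the tree theorem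
  `theta_criticalProb_eq_zero_of_sq_mul_expClusterSize_small`): letter (c) fails for D7, mechanically.

Nothing here is filed as an item; see the census for the verdict (no qualifying decomposition).
-/

noncomputable section

namespace Summit.CriticalPhenomena.PercolationContinuityZ3.Cruxes.FiniteClusterVolumeTail.DecompositionReexam

open MeasureTheory Filter Topology
open scoped Classical ENNReal
open Literature.Probability.Percolation Literature.Probability.LatticeModels
open Summit.CriticalPhenomena.PercolationContinuityZ3.Theses

/-! ## The driving fact: K is the conjunct -/

/-- The conjunct `θ(p_c(ℤ³)) = 0`. -/
abbrev S : Prop := _root_.PercolationContinuityZ3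

/-- The crux K (PercQuarantineIslands copy; the four route copies are one term). -/
abbrev K : Prop := PercQuarantineIslands.FiniteClusterVolumeTail

/-- K ↔ S, unconditional (lead c2, p158843). -/
theorem K_iff_S : K ↔ S :=
  Theorems.FiniteClusterVolumeTail.percQuarantineIslands_finiteClusterVolumeTail_iff_percolationContinuityZ3

/-- The PercDebrisSweep copy of K ↔ S (p158843). -/
theorem K_debrisSweep_iff_S : PercDebrisSweep.FiniteClusterVolumeTail ↔ S :=
  Theorems.FiniteClusterVolumeTail.percDebrisSweep_finiteClusterVolumeTail_iff_percolationContinuityZ3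

/-- D0 (PercQuarantineIslands): the deciding theorem's binder `hK` alone yields the conclusion. -/
theorem percQuarantineIslands_summit_of_K_alone (hK : K) : S := K_iff_S.mp hK

/-- D0 (PercDebrisSweep): the deciding theorem's binder `hK` alone yields the conclusion. -/
theorem percDebrisSweep_summit_of_K_alone (hK : PercDebrisSweep.FiniteClusterVolumeTail) : S :=
  K_debrisSweep_iff_S.mp hK

/-! ## The K-ladder `KEta η` (volume-tail exponent axis) -/

/-- Same-density finite-cluster tail with stretched exponent `η`:
`∀ p, θ(p) > 0 → ∃ c > 0, ∀ m ≥ 1, P_p(m ≤ |C(0)| < ∞) ≤ exp(-c m^η)`. `η = 2/3` is K. -/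
def KEta (η : ℝ) : Prop :=
  ∀ p : unitInterval, 0 < theta (zdGraph 3) 0 p → ∃ c : ℝ, 0 < c ∧ ∀ m : ℕ, 1 ≤ m →
    (bondPercolation (zdGraph 3) p).real
        {ω | (m : ℕ∞) ≤ (openCluster ω 0).encard ∧ (openCluster ω 0).Finite}
      ≤ Real.exp (-(c * (m : ℝ) ^ η))

/-- `KEta (2/3)` is literally K. -/
theorem kEta_twoThirds_iff_K : KEta ((2 : ℝ) / 3) ↔ K := Iff.rfl

/-- The ladder is monotone: a larger exponent is a stronger statement. -/
theorem kEta_anti {η η' : ℝ} (hle : η ≤ η') (h : KEta η') : KEta η := by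
  intro p hp
  obtain ⟨c, hc, hb⟩ := h p hp
  refine ⟨c, hc, fun m hm => (hb m hm).trans ?_⟩
  apply Real.exp_le_exp.mpr
  have h1 : (1 : ℝ) ≤ (m : ℝ) := by exact_mod_cast hm
  have hpow : (m : ℝ) ^ η ≤ (m : ℝ) ^ η' := Real.rpow_le_rpow_of_exponent_le h1 hle
  exact neg_le_neg (mul_le_mul_of_nonneg_left hpow hc.le)

/-- Every rung `η ≤ 2/3` is a CONSEQUENCE of the conjunct (via Kesten–Zhang above `p_c`, p153540). -/
theorem kEta_of_S {η : ℝ} (hη : η ≤ 2 / 3) (hS : S) : KEta η :=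
  kEta_anti hη (kEta_twoThirds_iff_K.mpr (K_iff_S.mpr hS))

/-! ## The γ-axis `ChiBelow g` -/

/-- Subcritical susceptibility exponent below `g`: `∃ γ < g, C, ∀ p < p_c, ∀ R, Σ_{x∈B(R)} τ_p(0,x) ≤ C (p_c-p)^{-γ}`.
`g = 3` is `PercDebrisSweep.SubcritChiBelowCube`. -/
def ChiBelow (g : ℝ) : Prop :=
  ∃ γ C : ℝ, γ < g ∧ (∀ p : unitInterval, (p : ℝ) < criticalProb (zdGraph 3) 0 → ∀ R : ℕ,
    ∑ x ∈ box 3 R, (bondPercolation (zdGraph 3) p).real (openConn 0 x)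
      ≤ C * (criticalProb (zdGraph 3) 0 - (p : ℝ)) ^ (-γ))

/-- `ChiBelow 3` is literally the PercDebrisSweep crux `SubcritChiBelowCube`. -/
theorem chiBelow_three_iff : ChiBelow 3 ↔ PercDebrisSweep.SubcritChiBelowCube := Iff.rfl

/-- Monotone in the threshold. -/
theorem chiBelow_mono {g g' : ℝ} (hle : g ≤ g') (h : ChiBelow g) : ChiBelow g' := by
  obtain ⟨γ, C, hγ, hb⟩ := h
  exact ⟨γ, C, hγ.trans_le hle, hb⟩

/-! ## D8 — the debris-sweep trade-off line `g < 1/(1-η)`, assembly PROVED (letter (b)) -/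

/-- **Debris sweep with general exponents.** For `0 < η` and `1 - 1/max g 1 ≤ η`:
`ChiBelow g → KEta η → DebrisFromChi → θ(p_c(ℤ³)) = 0`. At `(g, η) = (3, 2/3)` this is the route's `closes`;
the proof is that proof with the exponents as parameters (pure real analysis; no percolation estimate). -/
theorem summit_of_chiBelow_of_kEta {g η : ℝ} (hη0 : 0 < η) (hgη : 1 - 1 / max g 1 ≤ η)
    (hS : ChiBelow g) (hK : KEta η) (hD : PercDebrisSweep.DebrisFromChi) : S := by
  classical
  refine percolationContinuityZ3_iff.mpr ?_
  by_contra hne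
  -- a jump: θ* := θ(p_c) > 0
  have hθ : 0 < theta (zdGraph 3) 0 (criticalProbI 3) := by
    refine lt_of_le_of_ne ?_ (Ne.symm hne)
    unfold theta
    exact measureReal_nonneg
  obtain ⟨γ, C, hγg, hchi⟩ := hS
  have hγ'1 : (1 : ℝ) ≤ max γ 1 := le_max_right _ _
  have hγ'pos : (0 : ℝ) < max γ 1 := lt_of_lt_of_le one_pos hγ'1
  -- exponent bookkeeping: 1 - 1/γ' < η (strict because γ < g)
  have ha : 1 - 1 / max γ 1 < η := by
    rcases le_or_gt g 1 with hg1 | hg1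
    · have hγ1 : max γ 1 = 1 := max_eq_right (by linarith : γ ≤ 1)
      rw [hγ1]
      have h0 : (1 : ℝ) - 1 / 1 = 0 := by norm_num
      linarith
    · have hmg : max g 1 = g := max_eq_left hg1.le
      have hlt : max γ 1 < g := max_lt hγg hg1
      have h1 : 1 / g < 1 / max γ 1 := one_div_lt_one_div_of_lt hγ'pos hlt
      rw [hmg] at hgη
      linarith
  have hchi' : ∀ p : unitInterval, (p : ℝ) < criticalProb (zdGraph 3) 0 → ∀ R : ℕ,
      ∑ x ∈ box 3 R, (bondPercolation (zdGraph 3) p).real (openConn 0 x)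
        ≤ max C 0 * (criticalProb (zdGraph 3) 0 - (p : ℝ)) ^ (-(max γ 1)) := by
    intro p hp R
    have ht0 : 0 < criticalProb (zdGraph 3) 0 - (p : ℝ) := sub_pos.mpr hp
    have ht1 : criticalProb (zdGraph 3) 0 - (p : ℝ) ≤ 1 :=
      (sub_le_self _ p.2.1).trans (criticalProb_mem_Icc _ _).2
    calc ∑ x ∈ box 3 R, (bondPercolation (zdGraph 3) p).real (openConn 0 x)
        ≤ C * (criticalProb (zdGraph 3) 0 - (p : ℝ)) ^ (-γ) := hchi p hp R
      _ ≤ max C 0 * (criticalProb (zdGraph 3) 0 - (p : ℝ)) ^ (-γ) :=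
          mul_le_mul_of_nonneg_right (le_max_left _ _) (Real.rpow_nonneg ht0.le _)
      _ ≤ max C 0 * (criticalProb (zdGraph 3) 0 - (p : ℝ)) ^ (-(max γ 1)) :=
          mul_le_mul_of_nonneg_left
            (Real.rpow_le_rpow_of_exponent_ge ht0 ht1 (neg_le_neg (le_max_left γ 1)))
            (le_max_right _ _)
  -- (D) at (γ', C'): infinitely many sizes m carry debris mass ≥ exp(-C₁ (m^{1-1/γ'} + log m)) at p_c
  obtain ⟨C₁, hfreq⟩ := hD (max γ 1) (max C 0) hγ'pos hchi' hθ
  -- the rung η of the K-ladder at the (hypothetically percolating) parameter p_c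
  obtain ⟨c, hc, hKZ⟩ := hK (criticalProbI 3) hθ
  -- eventually (in the size m) the rung's upper bound is STRICTLY below the debris lower bound
  have hreal : ∀ᶠ x : ℝ in Filter.atTop,
      C₁ * (x ^ (1 - 1 / max γ 1) + Real.log x) < c * x ^ η := by
    rcases le_or_gt C₁ 0 with hC₁ | hC₁
    · filter_upwards [Filter.eventually_ge_atTop (1 : ℝ)] with x hx
      have hx0 : 0 < x := lt_of_lt_of_le one_pos hx
      have h1 : 0 ≤ x ^ (1 - 1 / max γ 1) + Real.log x :=
        add_nonneg (Real.rpow_nonneg hx0.le _) (Real.log_nonneg hx)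
      have h2 : 0 < c * x ^ η := mul_pos hc (Real.rpow_pos_of_pos hx0 _)
      exact lt_of_le_of_lt (mul_nonpos_of_nonpos_of_nonneg hC₁ h1) h2
    · have hε : 0 < c / (4 * C₁) := by positivity
      -- power part: x^{a} = x^{-(η - a)} · x^{η} with x^{-(η-a)} → 0
      have hpow : ∀ᶠ x : ℝ in Filter.atTop,
          x ^ (1 - 1 / max γ 1) ≤ c / (4 * C₁) * x ^ η := by
        have ht : Filter.Tendsto (fun x : ℝ => x ^ (-(η - (1 - 1 / max γ 1))))
            Filter.atTop (nhds 0) := tendsto_rpow_neg_atTop (by linarith)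
        filter_upwards [ht.eventually (gt_mem_nhds hε), Filter.eventually_gt_atTop (0 : ℝ)]
          with x hx hx0
        have hsplit : x ^ (1 - 1 / max γ 1)
            = x ^ (-(η - (1 - 1 / max γ 1))) * x ^ η := by
          rw [← Real.rpow_add hx0]
          congr 1
          ring
        rw [hsplit]
        exact mul_le_mul_of_nonneg_right hx.le (Real.rpow_nonneg hx0.le _)
      -- logarithmic part: log x = o(x^{η})
      have hlog : ∀ᶠ x : ℝ in Filter.atTop, Real.log x ≤ c / (4 * C₁) * x ^ η := by
        filter_upwards [(isLittleO_log_rpow_atTop hη0).def hε,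
          Filter.eventually_ge_atTop (1 : ℝ)] with x hx hx1
        rw [Real.norm_of_nonneg (Real.log_nonneg hx1),
          Real.norm_of_nonneg (Real.rpow_nonneg (zero_le_one.trans hx1) _)] at hx
        exact hx
      filter_upwards [hpow, hlog, Filter.eventually_gt_atTop (0 : ℝ)] with x hx1 hx2 hx0
      have hxη : 0 < x ^ η := Real.rpow_pos_of_pos hx0 _
      have hsum : x ^ (1 - 1 / max γ 1) + Real.log x ≤ c / (2 * C₁) * x ^ η := by
        have : c / (4 * C₁) * x ^ η + c / (4 * C₁) * x ^ η = c / (2 * C₁) * x ^ η := by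
          field_simp
          ring
        linarith
      calc C₁ * (x ^ (1 - 1 / max γ 1) + Real.log x)
          ≤ C₁ * (c / (2 * C₁) * x ^ η) := mul_le_mul_of_nonneg_left hsum hC₁.le
        _ = c / 2 * x ^ η := by
          field_simp
        _ < c * x ^ η := by nlinarith
  have hev : ∀ᶠ m : ℕ in Filter.atTop, 1 ≤ m ∧
      C₁ * ((m : ℝ) ^ (1 - 1 / max γ 1) + Real.log (m : ℝ)) < c * (m : ℝ) ^ η := by
    filter_upwards [(tendsto_natCast_atTop_atTop (R := ℝ)).eventually hreal,
      Filter.eventually_ge_atTop 1] with m hm h1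
    exact ⟨h1, hm⟩
  -- pick one such size m where debris is also present, and compare
  obtain ⟨m, hdebris, h1, hlt⟩ := (hfreq.and_eventually hev).exists
  have hmono : (bondPercolation (zdGraph 3) (criticalProbI 3)).real
        {ω | (openCluster ω 0).encard = (m : ℕ∞)}
      ≤ (bondPercolation (zdGraph 3) (criticalProbI 3)).real
        {ω | (m : ℕ∞) ≤ (openCluster ω 0).encard ∧ (openCluster ω 0).Finite} := by
    refine measureReal_mono ?_ (measure_ne_top _ _)
    intro ω hω
    simp only [Set.mem_setOf_eq] at hω ⊢
    exact ⟨hω.ge, Set.finite_of_encard_eq_coe hω⟩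
  have hchain := (hdebris.trans hmono).trans (hKZ m h1)
  have hstrict : Real.exp (-(c * (m : ℝ) ^ η))
      < Real.exp (-(C₁ * ((m : ℝ) ^ (1 - 1 / max γ 1) + Real.log (m : ℝ)))) :=
    Real.exp_lt_exp.mpr (neg_lt_neg hlt)
  exact absurd (hchain.trans_lt hstrict) (lt_irrefl _)

/-- D8 at the route's own pair `(3, 2/3)` is the route's `closes` again (sanity instance). -/
theorem summit_of_chiBelow_three_of_K (hS : ChiBelow 3) (hK : K) (hD : PercDebrisSweep.DebrisFromChi) : S :=
  summit_of_chiBelow_of_kEta (g := 3) (η := 2 / 3) (by norm_num)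
    (by rw [max_eq_left (by norm_num : (1 : ℝ) ≤ 3)]; norm_num) hS (kEta_twoThirds_iff_K.mpr hK) hD

/-- D8 at `(5/2, 3/5 + ε)`: a pair with BOTH pieces strictly off the known thresholds (`g > 2`: not Newman-free;
`η < 2/3`: not the conjunct by the strip theorem) — assembly proved; the census records why it still fails (d). -/
theorem summit_of_chiBelow_fiveHalves_of_kEta {η : ℝ} (hη : 3 / 5 < η)
    (hS : ChiBelow (5 / 2)) (hK : KEta η) (hD : PercDebrisSweep.DebrisFromChi) : S :=
  summit_of_chiBelow_of_kEta (g := 5 / 2) (lt_trans (by norm_num) hη)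
    (by rw [max_eq_left (by norm_num : (1 : ℝ) ≤ 5 / 2)]; linarith) hS hK hD

/-! ## D7 — at `g = 2` the γ-piece is summit-or-stronger ON ITS OWN (letter (c) fails), via Newman 1986 (tree) -/

/-- Every finite set of sites lies in some centred box (local copy of `exists_forall_subset_box`). [folklore] -/
theorem exists_subset_box (A : Finset (Site 3)) : ∃ L : ℕ, A ⊆ box 3 L := by
  refine ⟨A.sup fun x => Finset.univ.sup fun i => (x i).natAbs, fun x hx => ?_⟩
  rw [mem_box]
  intro i
  have h1 : (x i).natAbs ≤ Finset.univ.sup fun i => (x i).natAbs :=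
    Finset.le_sup (f := fun i => (x i).natAbs) (Finset.mem_univ i)
  have h2 : (Finset.univ.sup fun i => (x i).natAbs)
      ≤ A.sup fun x => Finset.univ.sup fun i => (x i).natAbs :=
    Finset.le_sup (f := fun x : Site 3 => Finset.univ.sup fun i => (x i).natAbs) hx
  omega

/-- Uniform box bounds on the two-point partial sums bound the susceptibility `χ(p) = Σ_x τ_p(0,x)` below `p_c`.
[folklore] -/
theorem chi_le_of_boxBound {γ C : ℝ}
    (hb : ∀ p : unitInterval, (p : ℝ) < criticalProb (zdGraph 3) 0 → ∀ R : ℕ,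
      ∑ x ∈ box 3 R, (bondPercolation (zdGraph 3) p).real (openConn 0 x)
        ≤ C * (criticalProb (zdGraph 3) 0 - (p : ℝ)) ^ (-γ))
    (p : unitInterval) (hp : (p : ℝ) < criticalProb (zdGraph 3) 0) :
    chi 3 p ≤ C * (criticalProb (zdGraph 3) 0 - (p : ℝ)) ^ (-γ) := by
  have hs := summable_tau_of_lt_criticalProb (d := 3) (by norm_num) p hp
  rw [chi_def]
  refine hs.tsum_le_of_sum_le fun s => ?_
  obtain ⟨L, hL⟩ := exists_subset_box s
  calc ∑ x ∈ s, tau 3 p 0 x ≤ ∑ x ∈ box 3 L, tau 3 p 0 x :=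
        Finset.sum_le_sum_of_subset_of_nonneg hL fun x _ _ => tau_nonneg p 0 x
    _ = ∑ x ∈ box 3 L, (bondPercolation (zdGraph 3) p).real (openConn 0 x) := by
        simp_rw [tau_def]
    _ ≤ C * (criticalProb (zdGraph 3) 0 - (p : ℝ)) ^ (-γ) := hb p hp L

/-- **D7: `ChiBelow 2` gives the conjunct on its own.** Newman's criterion ("`γ < 2 ⇒ θ(p_c) = 0`") is the tree theorem
`theta_criticalProb_eq_zero_of_sq_mul_expClusterSize_small` (`DiscontinuityGammaTwo.lean`, via Hutchcroft 2022 Thm 1.3);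
here it is fed with `χ(p) ≤ C (p_c - p)^{-γ}`, `γ < 2`, so that `(p_c - p)² χ(p) ≤ C (p_c-p)^{2-γ} → 0`. Hence the bridge split
`K ⇐ ChiBelow 2 ∧ (ChiBelow 2 → K)` has ONE open piece, which is a structured strengthening of the conjunct (RULE-N). -/
theorem summit_of_chiBelow_two (h : ChiBelow 2) : S := by
  obtain ⟨γ, C, hγ2, hb⟩ := h
  refine percolationContinuityZ3_iff.mpr
    (theta_criticalProb_eq_zero_of_sq_mul_expClusterSize_small (d := 3) (by norm_num) fun η hη => ?_)
  have hpc0 : 0 < criticalProb (zdGraph 3) (0 : Site 3) := criticalProb_zd_pos 3 (by norm_num)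
  have hpc1 : criticalProb (zdGraph 3) (0 : Site 3) < 1 := criticalProb_zd_lt_one (d := 3) (by norm_num)
  have hexp : 0 < 2 - γ := by linarith
  -- `max C 0 · t^{2-γ} → 0` as `t → 0⁺`
  have htend : Tendsto (fun t : ℝ => max C 0 * t ^ (2 - γ)) (𝓝[>] 0) (𝓝 0) := by
    have h1 : Tendsto (fun t : ℝ => t ^ (2 - γ)) (𝓝 (0 : ℝ)) (𝓝 0) := by
      have := (Real.continuousAt_rpow_const 0 (2 - γ) (Or.inr hexp.le)).tendsto
      simpa [Real.zero_rpow hexp.ne'] using this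
    have h2 := (h1.mono_left (nhdsWithin_le_nhds (s := Set.Ioi (0 : ℝ)))).const_mul (max C 0)
    simpa using h2
  have hhalf : (0 : ℝ) < criticalProb (zdGraph 3) (0 : Site 3) / 2 := by linarith
  obtain ⟨t, ⟨ht0, hthalf⟩, hsmall⟩ :
      ∃ t : ℝ, (t ∈ Set.Ioi (0 : ℝ) ∧ t < criticalProb (zdGraph 3) (0 : Site 3) / 2) ∧
        max C 0 * t ^ (2 - γ) < η := by
    have hev1 : ∀ᶠ t : ℝ in 𝓝[>] 0, t ∈ Set.Ioi (0 : ℝ) ∧ t < criticalProb (zdGraph 3) (0 : Site 3) / 2 :=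
      eventually_mem_nhdsWithin.and ((eventually_lt_nhds hhalf).filter_mono nhdsWithin_le_nhds)
    have hev2 : ∀ᶠ t : ℝ in 𝓝[>] 0, max C 0 * t ^ (2 - γ) < η := htend.eventually (gt_mem_nhds hη)
    exact (hev1.and hev2).exists
  have ht0' : 0 < t := ht0
  -- the parameter `q = p_c - t ∈ [p_c/2, p_c)`
  have hq01 : criticalProb (zdGraph 3) (0 : Site 3) - t ∈ unitInterval := ⟨by linarith, by linarith⟩
  set q : unitInterval := ⟨criticalProb (zdGraph 3) (0 : Site 3) - t, hq01⟩ with hqdef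
  have hq : (q : ℝ) = criticalProb (zdGraph 3) (0 : Site 3) - t := rfl
  have hqpc : (q : ℝ) < criticalProb (zdGraph 3) (0 : Site 3) := by rw [hq]; linarith
  have hgap : criticalProb (zdGraph 3) (0 : Site 3) - (q : ℝ) = t := by rw [hq]; ring
  refine ⟨q, by rw [hq]; linarith, hqpc, ?_⟩
  rw [expClusterSize_eq_ofReal_chi (d := 3) (by norm_num) q hqpc, ← ENNReal.ofReal_mul (sq_nonneg _), hgap]
  refine ENNReal.ofReal_le_ofReal ?_
  have hchi := chi_le_of_boxBound hb q hqpc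
  rw [hgap] at hchi
  calc t ^ 2 * chi 3 q
      ≤ t ^ 2 * (C * t ^ (-γ)) := mul_le_mul_of_nonneg_left hchi (sq_nonneg _)
    _ ≤ t ^ 2 * (max C 0 * t ^ (-γ)) :=
        mul_le_mul_of_nonneg_left (mul_le_mul_of_nonneg_right (le_max_left _ _) (Real.rpow_nonneg ht0'.le _))
          (sq_nonneg _)
    _ = max C 0 * t ^ (2 - γ) := by
        rw [show (2 : ℝ) - γ = 2 + -γ by ring, Real.rpow_add ht0', Real.rpow_two]
        ring
    _ ≤ η := hsmall.le

/-- Consequently `ChiBelow 2 ↔`-nothing is needed: the γ-piece at threshold 2 already closes both K and S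
(`ChiBelow 2 → K`), so in `K ⇐ ChiBelow 2 ∧ (ChiBelow 2 → K)` the second piece is a theorem and the first is a
one-piece strengthening (letters (a)/(c), RULE-N). -/
theorem K_of_chiBelow_two (h : ChiBelow 2) : K := K_iff_S.mpr (summit_of_chiBelow_two h)

/-! ## D9 — the islands axis `HArm a` (half-space one-arm exponent at `p_c`) -/

/-- Quantitative Barsky–Grimmett–Newman with exponent above `a` (HEIGHT version):
`∃ κ > 0, C, ∀ h ≥ 1, P_{p_c}(0 ↔ {x₀ = h} inside {x₀ ≥ 0}) ≤ C h^{-(a+κ)}`. `a = 4/5` is the PercQuarantineIslands crux H. -/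
def HArm (a : ℝ) : Prop :=
  ∃ κ C : ℝ, 0 < κ ∧ ∀ h : ℕ, 1 ≤ h → (bondPercolation (zdGraph 3) (criticalProbI 3)).real
    {ω | ∃ y : Site 3, y 0 = (h : ℤ) ∧ ω ∈ openConnIn {x : Site 3 | 0 ≤ x 0} 0 y} ≤ C * (h : ℝ) ^ (-(a + κ))

/-- `HArm (4/5)` is literally H = `PercQuarantineIslands.HalfSpaceOneArmFourFifths`. -/
theorem hArm_fourFifths_iff : HArm (4 / 5) ↔ PercQuarantineIslands.HalfSpaceOneArmFourFifths := Iff.rfl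

/-- Larger exponent, stronger statement. -/
theorem hArm_anti {a a' : ℝ} (hle : a ≤ a') (h : HArm a') : HArm a := by
  obtain ⟨κ, C, hκ, hb⟩ := h
  refine ⟨κ + (a' - a), C, by linarith, fun n hn => ?_⟩
  have : -(a + (κ + (a' - a))) = -(a' + κ) := by ring
  rw [this]
  exact hb n hn

/-- The islands assembly item (stmt-CriticalPhenomena-11237, "provable now, ~islands bookkeeping") is now closable
WITHOUT the islands argument: its fifth antecedent K already gives the conclusion. (So in the split
`K ⇐ H ∧ IslandsAssembly ∧ supports` every piece but K is idle — there is nothing to redirect to on this axis at η = 2/3.) -/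
theorem islandsAssembly_of_K_iff_S : PercQuarantineIslands.IslandsAssembly :=
  fun _ _ _ _ hK _ => K_iff_S.mp hK

/-- Likewise the PercDebrisSweep assembly item (stmt-CriticalPhenomena-10720). -/
theorem debrisSweepAssembly_of_K_iff_S : PercDebrisSweep.Assembly :=
  fun _ hK _ => K_debrisSweep_iff_S.mp hK

end Summit.CriticalPhenomena.PercolationContinuityZ3.Cruxes.FiniteClusterVolumeTail.DecompositionReexam
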